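import Summits.RiemannHypothesis.RiemannHypothesis.Theorems.SuzukiWindowsDoorSmallWindowLawReal
import Summits.RiemannHypothesis.RiemannHypothesis.Theorems.SuzukiWindowsDoorDecayExponentSmallWindow

/-!
# SuzukiWindowsDoorDecayExponentReal — the decay exponent's small-window limit and the bound on Suzuki's `μ₁` for every REAL pair `1 < θ₀ < θ₁` (column DBR; RH-FREE)

LINE 1 — LABEL: RH-FREE asymptotic theorems (t → 0⁺) about `𝖪_θ[t]` and Weil's ground energy `ε(t)`; bears_on: LADDER-RH
B-D(b) → B-P(P2)/(P2-flow) (PROOF-OF-DATA for the registered experiment EXP-R2a, TARGET-v10 §E.1, now for the FULL real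
family — in particular the pair `3/2 → 2` of the experiment and the `θ → 1⁺` regime its readings point to).  WHAT THIS IS NOT:
no sign of `ε(t)` at a fixed `t`, no window, nothing about `ζ`'s zeros; the `∀ t` antitone level stays RH-EQUIVALENT and
unclaimed; nothing here bears on the truth of RH.

For real `1 < θ₀ < θ₁`, families of bounded realisations `A₀ t`, `A₁ t` of `𝖪_{θ₀}[t]`, `𝖪_{θ₁}[t]`, realisations `B₀`,
`B₁` of the onset operators (kernels `(u+v)₊^{θ₀−1}`, `(u+v)₊^{θ₁−1}`), `L_i = c_{θ_i}‖B_i‖`, `c_θ = (2π)^θ/Γ(θ)`: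

* **`tendsto_decayExponent_sub_two_mul_log_real`**: `κ_op(t;θ₀,θ₁) − 2 log(1/t) → 2 log(L₀/L₁)/(θ₁−θ₀)`;
* **`tendsto_decayExponent_sub_two_mul_weilGroundEnergy_real`**, **`mu_one_le_real`**:
  `κ_op − 2ε → 2 log(L₀/L₁)/(θ₁−θ₀) − 2(μ₁ − log 2π − γ)` and `μ₁ ≤ log 2π + γ + log(L₀/L₁)/(θ₁ − θ₀)` for every `μ₁`
  admissible in Suzuki's small-window asymptotic (`Suzuki2026_thm_1_4_asymptotic_holds`), by `κ_op ≥ 2ε` (`opNorm_decay`);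
* **`mu_one_le_consecutive_real`**: for every real `θ₀ > 1`, `μ₁ ≤ γ + log(θ₀‖B₀‖/‖B₁‖)` with `B₁` a realisation of
  `A_{θ₀+1}` (`c_{θ₀}/c_{θ₀+1} = θ₀/(2π)` by `Γ(θ₀+1) = θ₀Γ(θ₀)`) — the family of bounds whose `θ₀ → 1⁺` end is the
  sharpest available from the integer/real laws (with the kernel bounds of `…SmallWindowLawReal` §2:
  `μ₁ ≤ γ + log(θ₀ · 2^{θ₀}/√((2θ₀−1)2θ₀) · (θ₀+1)√(2θ₀+3)/2^{θ₀+1})`, `→ γ + log(√5/√2·… ) ≈ 1.03` as `θ₀ → 1⁺`;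
  with exact norms `→ γ + log(‖A_1‖/‖A_2‖) ≈ 0.69`; numerics, not kernel).

References: [Su20] M. Suzuki, ASPM 84 (2020); [Su26] M. Suzuki, Thm 1.4; rh-dbr TARGET-v10 §E.1; DATA.md §EXP-R2a, §ET1i.
-/

noncomputable section

-- D-0017: `Summit.<S>.<S>.…` is the designed namespace of a single-problem summit.
set_option linter.dupNamespace false

open MeasureTheory Set Filter Topology

namespace Summit.RiemannHypothesis.RiemannHypothesis.Theorems.SuzukiWindowsDoorDecayExponentReal

open Literature.NumberTheory.LFunctions Literature.Analysis.OperatorTheory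
open Summit.RiemannHypothesis.RiemannHypothesis.Theorems.SuzukiWindowsDoorSmallWindowLawReal
open Summit.RiemannHypothesis.RiemannHypothesis.Theorems.SuzukiWindowsDoorDecayExponentSmallWindow
  (two_mul_weilGroundEnergy_le_decayExponent)

variable {θ₀ θ₁ : ℝ}
  {A₀ A₁ : ∀ t : ℝ, Lp ℝ 2 (volume.restrict (Ioo (-t) t)) →L[ℝ] Lp ℝ 2 (volume.restrict (Ioo (-t) t))}
  {B₀ B₁ : Lp ℝ 2 (volume.restrict (Ioo (-1 : ℝ) 1)) →L[ℝ] Lp ℝ 2 (volume.restrict (Ioo (-1 : ℝ) 1))}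

/-- **RH-FREE · the decay exponent in the small-window limit, real pairs**: for `1 < θ₀ < θ₁`,
`κ_op(t;θ₀,θ₁) − 2 log(1/t) → 2·log(L₀/L₁)/(θ₁ − θ₀)` as `t → 0⁺`, `L_i = c_{θ_i}‖B_i‖`. -/
theorem tendsto_decayExponent_sub_two_mul_log_real (hθ₀ : 1 < θ₀) (hθ : θ₀ < θ₁)
    (hA₀ : ∀ t φ, (A₀ t φ : ℝ → ℝ) =ᵐ[volume.restrict (Ioo (-t) t)]
      fun x => ∫ y in Ioo (-t) t, limKernel θ₀ (x + y) * φ y)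
    (hA₁ : ∀ t φ, (A₁ t φ : ℝ → ℝ) =ᵐ[volume.restrict (Ioo (-t) t)]
      fun x => ∫ y in Ioo (-t) t, limKernel θ₁ (x + y) * φ y)
    (hB₀ : ∀ φ, (B₀ φ : ℝ → ℝ) =ᵐ[volume.restrict (Ioo (-1 : ℝ) 1)]
      fun u => ∫ v in Ioo (-1 : ℝ) 1, (max (u + v) 0) ^ (θ₀ - 1) * φ v)
    (hB₁ : ∀ φ, (B₁ φ : ℝ → ℝ) =ᵐ[volume.restrict (Ioo (-1 : ℝ) 1)]
      fun u => ∫ v in Ioo (-1 : ℝ) 1, (max (u + v) 0) ^ (θ₁ - 1) * φ v) :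
    Tendsto (fun t : ℝ => Real.log (‖A₀ t‖ ^ 2 / ‖A₁ t‖ ^ 2) / (θ₁ - θ₀) - 2 * Real.log (1 / t))
      (𝓝[>] 0)
      (𝓝 (2 * Real.log (((2 * Real.pi) ^ θ₀ / Real.Gamma θ₀ * ‖B₀‖) /
          ((2 * Real.pi) ^ θ₁ / Real.Gamma θ₁ * ‖B₁‖)) / (θ₁ - θ₀))) := by
  have hθ₁ : 1 < θ₁ := lt_trans hθ₀ hθ
  have hΓ₀ : 0 < Real.Gamma θ₀ := Real.Gamma_pos_of_pos (by linarith)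
  have hΓ₁ : 0 < Real.Gamma θ₁ := Real.Gamma_pos_of_pos (by linarith)
  set L₀ : ℝ := (2 * Real.pi) ^ θ₀ / Real.Gamma θ₀ * ‖B₀‖ with hL₀
  set L₁ : ℝ := (2 * Real.pi) ^ θ₁ / Real.Gamma θ₁ * ‖B₁‖ with hL₁
  have hL₀pos : 0 < L₀ := by
    have := opNorm_onsetOp_pos_real hθ₀ hB₀
    have : 0 < (2 * Real.pi) ^ θ₀ := Real.rpow_pos_of_pos (by positivity) _
    positivity
  have hL₁pos : 0 < L₁ := by
    have := opNorm_onsetOp_pos_real hθ₁ hB₁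
    have : 0 < (2 * Real.pi) ^ θ₁ := Real.rpow_pos_of_pos (by positivity) _
    positivity
  have hdθpos : 0 < θ₁ - θ₀ := by linarith
  have hr₀ := tendsto_opNorm_winOp_div_rpow hθ₀ A₀ hA₀ hB₀
  have hr₁ := tendsto_opNorm_winOp_div_rpow hθ₁ A₁ hA₁ hB₁
  rw [← hL₀] at hr₀
  rw [← hL₁] at hr₁
  have hev₀ : ∀ᶠ t in 𝓝[>] (0 : ℝ), 0 < ‖A₀ t‖ / t ^ θ₀ := hr₀.eventually (eventually_gt_nhds hL₀pos)
  have hev₁ : ∀ᶠ t in 𝓝[>] (0 : ℝ), 0 < ‖A₁ t‖ / t ^ θ₁ := hr₁.eventually (eventually_gt_nhds hL₁pos)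
  have hlog : Tendsto (fun t : ℝ => 2 * (Real.log (‖A₀ t‖ / t ^ θ₀) - Real.log (‖A₁ t‖ / t ^ θ₁)) /
      (θ₁ - θ₀)) (𝓝[>] 0) (𝓝 (2 * (Real.log L₀ - Real.log L₁) / (θ₁ - θ₀))) :=
    ((((Real.continuousAt_log hL₀pos.ne').tendsto.comp hr₀).sub
      ((Real.continuousAt_log hL₁pos.ne').tendsto.comp hr₁)).const_mul 2).div_const _
  rw [← Real.log_div hL₀pos.ne' hL₁pos.ne'] at hlog
  refine hlog.congr' ?_
  filter_upwards [hev₀, hev₁, self_mem_nhdsWithin] with t h₀ h₁ ht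
  have ht0 : 0 < t := ht
  have htk₀ : 0 < t ^ θ₀ := Real.rpow_pos_of_pos ht0 _
  have htk₁ : 0 < t ^ θ₁ := Real.rpow_pos_of_pos ht0 _
  have hn₀ : 0 < ‖A₀ t‖ := by have := mul_pos h₀ htk₀; rwa [div_mul_cancel₀ _ htk₀.ne'] at this
  have hn₁ : 0 < ‖A₁ t‖ := by have := mul_pos h₁ htk₁; rwa [div_mul_cancel₀ _ htk₁.ne'] at this
  rw [Real.log_div hn₀.ne' htk₀.ne', Real.log_div hn₁.ne' htk₁.ne', Real.log_rpow ht0, Real.log_rpow ht0,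
    Real.log_div (pow_pos hn₀ 2).ne' (pow_pos hn₁ 2).ne', Real.log_pow, Real.log_pow, one_div, Real.log_inv]
  have hne : θ₁ - θ₀ ≠ 0 := hdθpos.ne'
  field_simp
  push_cast
  ring

/-- **RH-FREE · the decay exponent against Weil's ground energy, real pairs**: for every admissible `μ₁, C, a₀`,
`κ_op(t;θ₀,θ₁) − 2ε(t) → 2 log(L₀/L₁)/(θ₁−θ₀) − 2(μ₁ − log 2π − γ)`. -/
theorem tendsto_decayExponent_sub_two_mul_weilGroundEnergy_real (hθ₀ : 1 < θ₀) (hθ : θ₀ < θ₁)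
    (hA₀ : ∀ t φ, (A₀ t φ : ℝ → ℝ) =ᵐ[volume.restrict (Ioo (-t) t)]
      fun x => ∫ y in Ioo (-t) t, limKernel θ₀ (x + y) * φ y)
    (hA₁ : ∀ t φ, (A₁ t φ : ℝ → ℝ) =ᵐ[volume.restrict (Ioo (-t) t)]
      fun x => ∫ y in Ioo (-t) t, limKernel θ₁ (x + y) * φ y)
    (hB₀ : ∀ φ, (B₀ φ : ℝ → ℝ) =ᵐ[volume.restrict (Ioo (-1 : ℝ) 1)]
      fun u => ∫ v in Ioo (-1 : ℝ) 1, (max (u + v) 0) ^ (θ₀ - 1) * φ v)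
    (hB₁ : ∀ φ, (B₁ φ : ℝ → ℝ) =ᵐ[volume.restrict (Ioo (-1 : ℝ) 1)]
      fun u => ∫ v in Ioo (-1 : ℝ) 1, (max (u + v) 0) ^ (θ₁ - 1) * φ v)
    {μ₁ C a₀ : ℝ} (ha₀ : 0 < a₀)
    (hε : ∀ a : ℝ, 0 < a → a ≤ a₀ → |weilGroundEnergy a -
        (Real.log (1 / a) + μ₁ - Real.log (2 * Real.pi) - Real.eulerMascheroniConstant)| ≤ C * a) :
    Tendsto (fun t : ℝ => Real.log (‖A₀ t‖ ^ 2 / ‖A₁ t‖ ^ 2) / (θ₁ - θ₀) - 2 * weilGroundEnergy t)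
      (𝓝[>] 0)
      (𝓝 (2 * Real.log (((2 * Real.pi) ^ θ₀ / Real.Gamma θ₀ * ‖B₀‖) /
          ((2 * Real.pi) ^ θ₁ / Real.Gamma θ₁ * ‖B₁‖)) / (θ₁ - θ₀) -
        2 * (μ₁ - Real.log (2 * Real.pi) - Real.eulerMascheroniConstant))) := by
  have h1 := tendsto_decayExponent_sub_two_mul_log_real hθ₀ hθ hA₀ hA₁ hB₀ hB₁
  have h2 : Tendsto (fun t : ℝ => weilGroundEnergy t - Real.log (1 / t)) (𝓝[>] 0)
      (𝓝 (μ₁ - Real.log (2 * Real.pi) - Real.eulerMascheroniConstant)) := by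
    have key : ∀ᶠ t in 𝓝[>] (0 : ℝ), ‖(weilGroundEnergy t - Real.log (1 / t)) -
        (μ₁ - Real.log (2 * Real.pi) - Real.eulerMascheroniConstant)‖ ≤ |C| * t := by
      filter_upwards [Ioo_mem_nhdsGT ha₀] with t ht
      rw [Real.norm_eq_abs, show weilGroundEnergy t - Real.log (1 / t) -
          (μ₁ - Real.log (2 * Real.pi) - Real.eulerMascheroniConstant) =
        weilGroundEnergy t - (Real.log (1 / t) + μ₁ - Real.log (2 * Real.pi) - Real.eulerMascheroniConstant) by ring]
      exact (hε t ht.1 ht.2.le).trans (mul_le_mul_of_nonneg_right (le_abs_self C) ht.1.le)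
    have hlim : Tendsto (fun t : ℝ => |C| * t) (𝓝[>] 0) (𝓝 0) := by
      have h : Tendsto (fun t : ℝ => |C| * t) (𝓝 0) (𝓝 (|C| * 0)) := (continuous_const.mul continuous_id).tendsto 0
      rw [mul_zero] at h
      exact h.mono_left nhdsWithin_le_nhds
    exact tendsto_sub_nhds_zero_iff.1 (squeeze_zero_norm' key hlim)
  have h3 := h1.sub (h2.const_mul 2)
  refine h3.congr' (Eventually.of_forall fun t => ?_)
  simp only
  ring

/-- **RH-FREE · CROSS-COLUMN BOUND ON `μ₁`, real pairs**: for every admissible `μ₁` and every real pair `1 < θ₀ < θ₁`,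
`μ₁ ≤ log 2π + γ + log(L₀/L₁)/(θ₁ − θ₀)` (`κ_op ≥ 2ε` by the decay law `opNorm_decay`; both sides `2 log(1/t) + O(1)`).
Nothing here bears on RH. -/
theorem mu_one_le_real (hθ₀ : 1 < θ₀) (hθ : θ₀ < θ₁)
    (hA₀ : ∀ t φ, (A₀ t φ : ℝ → ℝ) =ᵐ[volume.restrict (Ioo (-t) t)]
      fun x => ∫ y in Ioo (-t) t, limKernel θ₀ (x + y) * φ y)
    (hA₁ : ∀ t φ, (A₁ t φ : ℝ → ℝ) =ᵐ[volume.restrict (Ioo (-t) t)]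
      fun x => ∫ y in Ioo (-t) t, limKernel θ₁ (x + y) * φ y)
    (hB₀ : ∀ φ, (B₀ φ : ℝ → ℝ) =ᵐ[volume.restrict (Ioo (-1 : ℝ) 1)]
      fun u => ∫ v in Ioo (-1 : ℝ) 1, (max (u + v) 0) ^ (θ₀ - 1) * φ v)
    (hB₁ : ∀ φ, (B₁ φ : ℝ → ℝ) =ᵐ[volume.restrict (Ioo (-1 : ℝ) 1)]
      fun u => ∫ v in Ioo (-1 : ℝ) 1, (max (u + v) 0) ^ (θ₁ - 1) * φ v)
    {μ₁ C a₀ : ℝ} (ha₀ : 0 < a₀)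
    (hε : ∀ a : ℝ, 0 < a → a ≤ a₀ → |weilGroundEnergy a -
        (Real.log (1 / a) + μ₁ - Real.log (2 * Real.pi) - Real.eulerMascheroniConstant)| ≤ C * a) :
    μ₁ ≤ Real.log (2 * Real.pi) + Real.eulerMascheroniConstant +
      Real.log (((2 * Real.pi) ^ θ₀ / Real.Gamma θ₀ * ‖B₀‖) /
          ((2 * Real.pi) ^ θ₁ / Real.Gamma θ₁ * ‖B₁‖)) / (θ₁ - θ₀) := by
  have hθ₁ : 1 < θ₁ := lt_trans hθ₀ hθ
  have hΓ₁ : 0 < Real.Gamma θ₁ := Real.Gamma_pos_of_pos (by linarith)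
  have hg := tendsto_decayExponent_sub_two_mul_weilGroundEnergy_real hθ₀ hθ hA₀ hA₁ hB₀ hB₁ ha₀ hε
  set L₁ : ℝ := (2 * Real.pi) ^ θ₁ / Real.Gamma θ₁ * ‖B₁‖ with hL₁
  have hL₁pos : 0 < L₁ := by
    have := opNorm_onsetOp_pos_real hθ₁ hB₁
    have : 0 < (2 * Real.pi) ^ θ₁ := Real.rpow_pos_of_pos (by positivity) _
    positivity
  have hr₁ := tendsto_opNorm_winOp_div_rpow hθ₁ A₁ hA₁ hB₁
  rw [← hL₁] at hr₁
  have hev : ∀ᶠ t in 𝓝[>] (0 : ℝ),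
      0 ≤ Real.log (‖A₀ t‖ ^ 2 / ‖A₁ t‖ ^ 2) / (θ₁ - θ₀) - 2 * weilGroundEnergy t := by
    filter_upwards [hr₁.eventually (eventually_gt_nhds hL₁pos), self_mem_nhdsWithin] with t h₁ ht
    have ht0 : 0 < t := ht
    have htk : 0 < t ^ θ₁ := Real.rpow_pos_of_pos ht0 _
    have hn₁ : 0 < ‖A₁ t‖ := by have := mul_pos h₁ htk; rwa [div_mul_cancel₀ _ htk.ne'] at this
    have h := two_mul_weilGroundEnergy_le_decayExponent ht0 hθ₀ hθ (hA₀ t) (hA₁ t) hn₁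
    linarith
  have h0 : 0 ≤ 2 * Real.log (((2 * Real.pi) ^ θ₀ / Real.Gamma θ₀ * ‖B₀‖) / L₁) / (θ₁ - θ₀) -
      2 * (μ₁ - Real.log (2 * Real.pi) - Real.eulerMascheroniConstant) :=
    ge_of_tendsto hg hev
  have hdθ : 0 < θ₁ - θ₀ := by linarith
  have : Real.log (((2 * Real.pi) ^ θ₀ / Real.Gamma θ₀ * ‖B₀‖) / L₁) / (θ₁ - θ₀) =
      2 * Real.log (((2 * Real.pi) ^ θ₀ / Real.Gamma θ₀ * ‖B₀‖) / L₁) / (θ₁ - θ₀) / 2 := by ring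
  linarith

/-- `c_θ‖B₀‖/(c_{θ+1}‖B₁‖) = θ‖B₀‖/(2π‖B₁‖)` for real `θ > 0` (`Γ(θ+1) = θΓ(θ)`). -/
theorem leading_ratio_consecutive_real {θ : ℝ} (hθ : 0 < θ) (x y : ℝ) (hy : y ≠ 0) :
    ((2 * Real.pi) ^ θ / Real.Gamma θ * x) / ((2 * Real.pi) ^ (θ + 1) / Real.Gamma (θ + 1) * y) =
      θ * x / (2 * Real.pi * y) := by
  have hπ : (0 : ℝ) < 2 * Real.pi := by positivity
  have hΓ : Real.Gamma θ ≠ 0 := (Real.Gamma_pos_of_pos hθ).ne'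
  have hp : (2 * Real.pi) ^ θ ≠ 0 := (Real.rpow_pos_of_pos hπ θ).ne'
  rw [Real.Gamma_add_one hθ.ne', Real.rpow_add_one hπ.ne']
  field_simp

/-- **RH-FREE · the consecutive-pair bound for every real `θ₀ > 1`**: `μ₁ ≤ γ + log(θ₀‖B₀‖/‖B₁‖)`, `B₀`, `B₁` any
realisations of `A_{θ₀}`, `A_{θ₀+1}` — the bound family whose small-`θ₀` end is the sharpest (EXP-R2a Q2's «Weil-extremality
at small θ», in the `t → 0⁺` corner).  Nothing here bears on RH. -/
theorem mu_one_le_consecutive_real (hθ₀ : 1 < θ₀)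
    (hA₀ : ∀ t φ, (A₀ t φ : ℝ → ℝ) =ᵐ[volume.restrict (Ioo (-t) t)]
      fun x => ∫ y in Ioo (-t) t, limKernel θ₀ (x + y) * φ y)
    (hA₁ : ∀ t φ, (A₁ t φ : ℝ → ℝ) =ᵐ[volume.restrict (Ioo (-t) t)]
      fun x => ∫ y in Ioo (-t) t, limKernel (θ₀ + 1) (x + y) * φ y)
    (hB₀ : ∀ φ, (B₀ φ : ℝ → ℝ) =ᵐ[volume.restrict (Ioo (-1 : ℝ) 1)]
      fun u => ∫ v in Ioo (-1 : ℝ) 1, (max (u + v) 0) ^ (θ₀ - 1) * φ v)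
    (hB₁ : ∀ φ, (B₁ φ : ℝ → ℝ) =ᵐ[volume.restrict (Ioo (-1 : ℝ) 1)]
      fun u => ∫ v in Ioo (-1 : ℝ) 1, (max (u + v) 0) ^ θ₀ * φ v)
    {μ₁ C a₀ : ℝ} (ha₀ : 0 < a₀)
    (hε : ∀ a : ℝ, 0 < a → a ≤ a₀ → |weilGroundEnergy a -
        (Real.log (1 / a) + μ₁ - Real.log (2 * Real.pi) - Real.eulerMascheroniConstant)| ≤ C * a) :
    μ₁ ≤ Real.eulerMascheroniConstant + Real.log (θ₀ * ‖B₀‖ / ‖B₁‖) := by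
  have hθ0 : 0 < θ₀ := by linarith
  have hB₁' : ∀ φ, (B₁ φ : ℝ → ℝ) =ᵐ[volume.restrict (Ioo (-1 : ℝ) 1)]
      fun u => ∫ v in Ioo (-1 : ℝ) 1, (max (u + v) 0) ^ (θ₀ + 1 - 1) * φ v := fun φ => by
    rw [add_sub_cancel_right]; exact hB₁ φ
  have h := mu_one_le_real (A₀ := A₀) (A₁ := A₁) hθ₀ (by linarith : θ₀ < θ₀ + 1) hA₀ hA₁ hB₀ hB₁' ha₀ hε
  have hB₁pos : 0 < ‖B₁‖ := opNorm_onsetOp_pos_real (by linarith) hB₁'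
  have hB₀pos : 0 < ‖B₀‖ := opNorm_onsetOp_pos_real hθ₀ hB₀
  have hπ : 0 < Real.pi := Real.pi_pos
  rw [leading_ratio_consecutive_real hθ0 ‖B₀‖ ‖B₁‖ hB₁pos.ne', show θ₀ + 1 - θ₀ = 1 by ring, div_one,
    show θ₀ * ‖B₀‖ / (2 * Real.pi * ‖B₁‖) = (θ₀ * ‖B₀‖ / ‖B₁‖) / (2 * Real.pi) by field_simp,
    Real.log_div (by positivity) (by positivity)] at h
  linarith

end Summit.RiemannHypothesis.RiemannHypothesis.Theorems.SuzukiWindowsDoorDecayExponentReal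

end
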